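import Mathlib
import HarnessLib
import HarnessLib.Audit
import Summits.ResolutionOfSingularities.Statement
import Literature.AlgebraicGeometry.Resolution.LocalBlowup
import Literature.AlgebraicGeometry.Resolution.RankOneReductionProofs
import Literature.AlgebraicGeometry.Resolution.LocalUniformization
import HarnessLib.Audit.Status.Attr

/-!
Route: AnalyticWildDescent

# Route AnalyticWildDescent — Galois-equivariant semistable local uniformization + vertical wild
quotients, descended along the decomposition group

It suffices to show X = C1 ∧ C2 ∧ C3 (typed from sketch `analytic-lu-vertical-wild-descent`,
markdown-first wave). C1
EquivariantSemistableLU: given a k-variety germ B ⊆ O (k = k̄ of char p, O a height-one valuation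
ring of K = Frac B) fibred by a
non-unit t with smooth generic fibre, some finite Galois K₁/K coming from a one-variable function
field L = k(t, θ) carries a
ϖ-admissible ideal J of the model B·Λ' (Λ' = O₁ ∩ L a DVR, O₁ | O), STABLE under the decomposition
group D = Stab(Λ'), whose local
blow-up along O₁ is SEMISTABLE over Λ' (regular, ϖ = unit × product of parameters). C2
VerticalWildQuotientLU: for any finite D acting
faithfully on Λ' and any D-stable ϖ-admissible centre of a D-stable model with semistable local
blow-up B₂, the invariant side admits a
finite tower of Λ'-admissible local blow-ups along O₁ ∩ K₁^D ending REGULAR. C3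
SwallowingPencilDecompletion: C1 → C2 → height-one
relative local uniformization over algebraically closed ground fields (local Bertini pencil +
decomposition-group bookkeeping +
Nisnevich tower descent). The deciding theorem then runs Novacoski–Spivakovsky (all heights),
patching over perfect fields and the
two shared descents.
Lean: `EquivariantSemistableLU ∧ VerticalWildQuotientLU ∧ SwallowingPencilDecompletion`

## Assembly
The deciding theorem `closes` (glue.lean, sorry-free, standard axioms) takes the six items: fix p;
DescentPerfectToAll and
DescentAlgclosedToPerfect reduce to k algebraically closed; PatchingPerfect reduces to relative
local uniformization of function
fields K/k along valuations O containing k;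
`Literature.AlgebraicGeometry.Resolution.NovacoskiSpivakovsky2014_holds` (in tree) reduces
to height-one O, which is SwallowingPencilDecompletion applied to EquivariantSemistableLU and
VerticalWildQuotientLU; the affine
model bookkeeping uses `exists_affineModel` and `isFractionRing_subalgebra_of_le` (in tree). Cone of
`closes` = 3 cruxes + 3 shared
supports; the Assembly item below is the type of `closes` itself.

Rationale: WHY THIS LINE. Semistable reduction exists after finite base change for curves (Deligne–Mumford, de
Jong) and, in characteristic zero, in all
dimensions (KKMS); in characteristic p only the ALTERED local version is known (Temkin2017Altered
Thm 1.2.8/3.4.1) and the local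
semistable uniformization conjecture is explicitly open from relative dimension 2 (Temkin2023 Conj.
3.1.16, Rem. 3.1.19). The
obstruction to un-altering is a finite group: Zavyalov2024 (Thm 1.4, Rem. 1.5) shows every
O_K-variety is, locally, a quotient of a
polystable fibration by groups acting HORIZONTALLY (O_K-linearly), so that "descend LU along such
quotients" is all of local
uniformization again. This line rotates the group into the BASE: fibre the germ by a pencil t (C3),
semistabilise after a Galois base
trait coming from the t-line (C1, the price being D-stability of the centre), and descend along the
decomposition group D, which acts
VERTICALLY — faithfully on the uniformizer, semilinearly over Λ'/Λ'^D — so the quotient problem C2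
sees a semistable ring with a
D-action of arithmetic origin (inertia = P ⋊ μ_e, Artin–Schreier layers), where the
Király–Lütkebohmert regularity criterion
(KiralyLutkebohmert2013 Thm 2, in tree) and Bergh–Rydh destackification (BerghRydh2019, tame layers)
give a concrete blow-up game.
Imported areas: non-archimedean/semistable reduction theory (Temkin, Zavyalov), wild quotient
singularities (Lorenzini2013,
ObusWewers2019, Kiraly–Lütkebohmert), valuation theory (NovacoskiSpivakovsky2014 in tree). No prior
route of the sub has a
base-change/decomposition-group lever (WildQuotient/WildQuotients: horizontal quotients of regular
varieties; VerticalModels: models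
over k(t) without group); the negatives index (3 entries) is untouched.

RANKED CRUXES. #2 EquivariantSemistableLU (crux) — equivariant local semistable reduction after a
Galois base trait: for B ⊆ O ⊆ K as above with t ∈ B, v(t) > 0 and B smooth over k(t), there are a
finite Galois K₁/K, O₁ | O, a Gal-stable one-variable function field L = k(t, θ) with K·L = K₁, a
uniformizer ϖ of Λ' = O₁ ∩ L, a ϖ-admissible ideal J of B₁ = B·Λ' stable under D = {σ | σΛ' ⊆ O₁},
and the local blow-up B₂ of B₁ along J at the centre of O₁, with B₂ regular and ϖ = unit · ∏ of a
part of a regular system of parameters (sketch K1; Temkin's Conj. 3.1.16 in algebraic dress +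
D-stability). [difficulty: open-problem] (why it might fail: semistable LU itself is open from
relative dim 2 in char p (only the altered version is known), and D-STABILITY of the centre is
extra: semistable modifications are not canonical above relative dim 1, so conjugate centres may
have no common semistable refinement.) [Temkin2023, Temkin2017Altered, Zavyalov2024, DeJong1996]
#3 VerticalWildQuotientLU (crux) — local uniformization of vertically ramified wild quotients of
semistable local rings: k = k̄ of char p, K₁ a field, D ≤ Aut_k(K₁) finite, O₁ a height-one
valuation ring of K₁, L = k(ϖ, θ) a one-variable function field with ϖ a uniformizer of Λ' = O₁ ∩ L,
D stabilising Λ' and acting faithfully on it; C₁ ⊇ Λ' finitely generated and D-stable, J ⊆ C₁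
ϖ-admissible and D-stable with local blow-up B₂ along O₁ semistable over Λ'. Then on F₀ = K₁^D the
ring C₁ ∩ F₀ admits a finite tower of local blow-ups along O₁ ∩ F₀, each centre containing a nonzero
element of Λ'^D, ending in a regular local ring (sketch K2 — the new lever). [difficulty: XL] (why
it might fail: wild ℤ/p-quotient singularities are resolved only for surfaces; in relative dim ≥ 2
the equivariant game making each augmentation ideal principal (KL criterion) may not terminate, and
ϖ-supported centres may be too few to separate the fixed locus.) [KiralyLutkebohmert2013,
BerghRydh2019, Lorenzini2013, ObusWewers2019, Zavyalov2024]
#4 SwallowingPencilDecompletion (crux) — the glue: C1 and C2 imply relative local uniformization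
along every height-one valuation of a function field over an algebraically closed field of
characteristic p (local Bertini pencil making the germ smooth over k(t); re-presentation L = k(ϖ,
θ') and the quotient datum for D = Stab(Λ') = inertia; Nisnevich descent of the admissible tower
from K₁^D = K·L^D, étale-local over K with e = f = 1 at the centre, back to K). [deps:
EquivariantSemistableLU, VerticalWildQuotientLU] [difficulty: L] (why it might fail: tower descent
needs each downstairs centre to meet Λ'^D nontrivially (typed so) and Λ'^D/k[t]_(t) étale-local with
e = f = 1 (uses D = full inertia, k = k̄); the local Bertini pencil needs B localised at a
value-zero element first — a slip breaks the glue, not the line.) [NovacoskiSpivakovsky2014,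
Temkin2023, KnafKuhlmann2005, CossartPiltant2019]
#9 PatchingPerfect (support) — (shared, = stmt-ResolutionOfSingularities-16089 of routes
IndSmooth/AbhyankarShadows, verbatim) over a perfect field of characteristic p, relative local
uniformization of all function fields along all valuations implies weak resolution of every reduced
separated finite-type scheme (Zariski–Abhyankar–Piltant patching in the form the tree's routes use).
[difficulty: XL] [CossartPiltant2019, NovacoskiSpivakovsky2014]
#9 DescentAlgclosedToPerfect (support) — (shared, = stmt-ResolutionOfSingularities-0550, verbatim)
weak resolution in characteristic p descends from algebraically closed to perfect ground fields.
[difficulty: L] [CossartPiltant2019, DeJong1996]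
#9 DescentPerfectToAll (support) — (shared, = stmt-ResolutionOfSingularities-0549, verbatim) weak
resolution in characteristic p descends from perfect to arbitrary ground fields. [difficulty: XL]
[CossartPiltant2019, DeJong1996]

TWO-LAYER PLAN. Foreseen glued splits (registered birth skeletons, bc/*_birth.lean, filed as
Lines/birth.lean after open; nothing is an item now):
EquivariantSemistableLU ⇐ SimultaneousSemistableLU (Temkin's conjecture at the finitely many
D-conjugates of the valuation) →
EquivariantReuniformization (D-stable admissible re-resolution of the join) → C1.
VerticalWildQuotientLU ⇐ InvariantRegularization
(equivariant admissible tower upstairs making the inertia-invariants regular: KL game on ℤ/p layers,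
toroidal on tame layers) →
TowerTransport (Veronese quotient charts + X/I_ξ → X/D étale) → C2, with the tame-cyclic case as the
first rung.
SwallowingPencilDecompletion ⇐ LocalBertiniPencil → QuotientDatum → TowerDescent → C3.

KILL CRITERIA. A counterexample to D-stability in C1 (a semistable local model over Λ' none of whose
D-conjugate-compatible admissible refinements is
semistable) refutes EquivariantSemistableLU as typed — pivot: restate C1/C2 with the stabiliser of
the centre and orbit charts (new
items, same lever) or close `refuted:EquivariantSemistableLU` if the obstruction is intrinsic. A
vertical wild quotient of a semistable
local ring with NO admissible uniformizing tower (e.g. an Artin–Schreier quotient in relative dim 2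
whose invariant ring resists every
ϖ-supported centre) refutes VerticalWildQuotientLU and closes the route outright
(`refuted:VerticalWildQuotientLU`): the lever is dead.
A refutation of SwallowingPencilDecompletion is a glue bug — repair by restating (misstated class),
not a kill. Local uniformization in
char p proved elsewhere (any route closing RelLocalUniformization in height one over k̄) moots
C1–C3; the shared supports are mooted with
their home routes.

NOT DECOMPOSED YET. The dévissage of the inertia group (P ⋊ μ_e: p-cyclic layers, then tame) inside
InvariantRegularization and the strengthened
"semistable end" form of C2 it needs; the equivariant principalisation game for one ℤ/p layer in
relative dim ≥ 2 (children of
VerticalWildQuotientLU); the choice of the Galois closure and of θ' (L/k(ϖ) separable since ϖ ∉ L^p)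
inside QuotientDatum; constants of
the local Bertini pencil (k infinite, localisation at a value-zero element). All are layer-2
children or prover-side `--supports` lemmas.

CHEAPEST FALSIFIER. Literature/expert lookup already run: is EQUIVARIANT
(decomposition-group-stable) semistable modification known to FAIL above relative
dimension one? Found only non-uniqueness (Zavyalov2024 p. 5: "we cannot expect uniqueness of the
minimal semistable modification in
higher dimension") and the altered theorem (Temkin2017Altered) — no counterexample to equivariance;
informative either way. Next
cheapest, runnable by a prover this week: the TAME-CYCLIC rung of VerticalWildQuotientLU
(stub_tameCyclicCase) from the tree's named
fact `BerghRydh2019_tameQuotientResolution` + admissibility of centres over the non-free locus — if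
even the tame vertical case does
not type-close, C2 is mis-typed.

NUMBERS. Known regime of S: dim ≤ 3 all characteristics (CossartPiltant2019); semistable reduction:
relative dim 1 (all p), all dims in char 0,
altered in char p (Temkin2017Altered Thm 1.2.8); wild quotient singularities resolved: surfaces
(Lorenzini2013; KiralyLutkebohmert2013
criterion for ℤ/p); tame quotients: all dimensions (BerghRydh2019). Items at open: 6 (3 cruxes, 3
shared supports); birth skeletons: 8
stubs (2 + 3 + 3).

DEFINITION REQUESTS. None. Semistability, admissibility, decomposition groups and the towers are
spelled out inside the statements over Mathlib
(`ValuationSubring`, `IntermediateField.fixedField`, `IsRegularLocalRing`, `Relation.ReflTransGen`)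
and the tree's
`Literature.AlgebraicGeometry.Resolution.IsLocalBlowupAlong` / `RelLocalUniformization`; a later
definition item
`IsSemistableLocalRingOver Λ B` (Summits/…/Theorems) would shorten C1/C2 but is not needed to type
them.

Novelty: Searches (2026-08-17): `lit search --hybrid "semistable reduction local uniformization positive
characteristic"` (Temkin2023 arXiv:2301.09160, Temkin2017Altered arXiv:1503.05729 held); `lit search
--hybrid "quotient of semistable curve fibration finite group local structure"` (Zavyalov2024
arXiv:2102.04752 held, read pp. 4–5, 17–18); `lit search --hybrid "wild quotient singularities
resolution positive characteristic Artin-Schreier"` (8: Kollár 2007 chunks 73–81, CJS2020 p.187 —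
tame/surface only); `lit vsearch "resolution of quotients by wild order p group actions … open in
higher dimension"` (8, same); `lit galaxy search "semistable reduction|local uniformization|wild
quotient singularit|altered local uniformization" --star all` (no relevant hit beyond held Berkovich
LNM 2119); `lit galaxy search "wild quotient singularit|wildly ramified|destackification" --star
all` (20 rows, none on resolution; nearest pdf:8085413315056857140 Obus 2017); `lit frontier
ResolutionOfSingularities --since 2020`, `lit bridges ResolutionOfSingularities --cross any` (run at
scoping; no paper joining semistable reduction to LU via vertical quotients); crossref/zbMATH:
Lorenzini2013 doi:10.1007/s00209-012-1132-7, Lorenzini–Schröer 2023 doi:10.2140/ant.2023.17.1017,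
ObusWewers2019 doi:10.1090/jag/745, Peskin 1983 doi:10.1016/0021-8693(83)90210-7; `lean search` for
every constant; `ledger negatives --problem ResolutionOfSingularities` (3, unrelated).
Nearest prior art found: Zavyalov2024 (arXiv:2102  [refs: 10.1007/s00209-012-1132-7, 10.2140/ant.2023.17.1017, 10.1090/jag/745, 10.1016/0021-8693(83, 2301.09160, 1503.05729, 2102.04752, doi:10.1007/s00209-012-1132-7, doi:10.2140/ant.2023.17.1017, doi:10.1090/jag/745, doi:10.1016/0021-8693, Temkin2023, Zavyalov2024, Lorenzini2013, ObusWewers2019]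

Barriers (technique_class: semistable-reduction, wild-quotient, local-uniformization): - technique_class: wild-base-change semistable-reduction, decomposition-group wild-quotient
local-uniformization (valuation-LU), nisnevich descent; load-bearing shared supports:
local-uniformization + zariski-patching (PatchingPerfect), galois-descent-from-algebraic-closure
(DescentAlgclosedToPerfect), perfect-to-arbitrary ground-field descent (DescentPerfectToAll)
- Literature.Barriers.ResolutionOfSingularities.ArtinSchreierPuiseuxNarrow: evaded — C1 quantifies
over ARBITRARY finite Galois K₁/K induced from separable extensions of L = k(t, θ) (Artin–Schreier
towers included), never over Kummer/Puiseux roots of t (the Chevalley obstruction of the same file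
bites exactly the tame-only base change x ↦ sⁿ); the barrier bites any attempt to prove C1 with tame
base change only (x^p·y = ϖ needs an AS extension).
- Literature.Barriers.ResolutionOfSingularities.Cutkosky2014: outside its class — no crux asserts a
(weak or strong) monomial form of the finite map Y → Y/D along the valuation (Cutkosky's defect
obstruction to local monomialization); C2 asks only for local uniformization of the INVARIANT ring
by ϖ-admissible blow-ups, C3 only transports regular local rings down an étale-local extension with
e = f = 1.
- Literature.Barriers.ResolutionOfSingularities.DimensionFourFrontier: outside for the three cruxes
— no embedded-resolution / Zariski-patching induction on dimension inside C1–C3 (height-one LU is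
produced directly, all heights by the in-tree Novacoski–Spivakovsky reduction)

sub-problem: ResolutionOfSingularities · status: draft · opened planner-type-99fce32726-0 2026-08-17T16:47:52Z · rev 4 · ledger route-ResolutionOfSingularities-AnalyticWildDescent
GENERATED by the gate from the ledger (D-0016/17). Provers cite these decls: `theorem foo : Summit.ResolutionOfSingularities.ResolutionOfSingularities.Theses.AnalyticWildDescent.<Decl> := …` in Summits/ResolutionOfSingularities/ResolutionOfSingularities/Theorems/<Name>.lean.
-/

namespace Summit.ResolutionOfSingularities.ResolutionOfSingularities.Theses.AnalyticWildDescent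

open scoped BigOperators Topology Manifold Classical MeasureTheory ProbabilityTheory Matrix InnerProductSpace ComplexConjugate ContinuousMap
open Filter Set Function TopologicalSpace MeasureTheory

attribute [summit_statement] _root_.ResolutionOfSingularities

/-- item stmt-ResolutionOfSingularities-18606 · crux · rank 2 · open · by planner
why it might fail: semistable LU itself is open from relative dim 2 in char p (only the altered version is known), and D-STABILITY of the centre is extra: semistable modifications are not canonical above relative dim 1, so conjugate centres may have no common semistable refinement.
sources: Temkin2023, Temkin2017Altered, Zavyalov2024, DeJong1996
[crux] equivariant local semistable reduction after a Galois base trait: for B ⊆ O ⊆ K as above with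
t ∈ B, v(t) > 0 and B smooth over k(t), there are a finite Galois K₁/K, O₁ | O, a Gal-stable
one-variable function field L = k(t, θ) with K·L = K₁, a uniformizer ϖ of Λ' = O₁ ∩ L, a
ϖ-admissible ideal J of B₁ = B·Λ' stable under D = {σ | σΛ' ⊆ O₁}, and the local blow-up B₂ of B₁
along J at the centre of O₁, with B₂ regular and ϖ = unit · ∏ of a part of a regular system of
parameters (sketch K1; Temkin's Conj. 3.1.16 in algebraic dress + D-stability). [difficulty:
open-problem] -/
@[route_item "route-ResolutionOfSingularities-AnalyticWildDescent", crux]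
def EquivariantSemistableLU : Prop :=
  ∀ p : ℕ, p.Prime → ∀ (k : Type) [Field k] [CharP k p] [IsAlgClosed k] (K : Type) [Field K] [Algebra k K] (O : ValuationSubring K) (t : K) (B : Subalgebra k K), Nonempty O.valuation.RankOne → (∀ c : k, algebraMap k K c ∈ O) → t ∈ B → t ≠ 0 → O.valuation t < 1 → B.FG → IsFractionRing B K → B.toSubring ≤ O.toSubring → Algebra.Smooth (IntermediateField.adjoin k ({t} : Set K)) (Algebra.adjoin (IntermediateField.adjoin k ({t} : Set K)) (B : Set K)) → ∃ (K₁ : Type) (_ : Field K₁) (_ : Algebra k K₁) (_ : Algebra K K₁) (_ : IsScalarTower k K K₁) (_ : FiniteDimensional K K₁) (_ : IsGalois K K₁) (O₁ : ValuationSubring K₁) (L : IntermediateField k K₁) (θ ϖ : K₁) (B₂ : Subring K₁), (∀ x : K, algebraMap K K₁ x ∈ O₁ ↔ x ∈ O) ∧ IsAlgebraic (IntermediateField.adjoin k ({algebraMap K K₁ t} : Set K₁)) θ ∧ L = IntermediateField.adjoin k ({algebraMap K K₁ t, θ} : Set K₁) ∧ (∀ σ : K₁ ≃ₐ[K] K₁,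 ∀ x ∈ L, σ x ∈ L) ∧ Algebra.adjoin K (L : Set K₁) = ⊤ ∧ ϖ ∈ L ∧ O₁.valuation ϖ < 1 ∧ (∀ x ∈ L, O₁.valuation x < 1 → O₁.valuation x ≤ O₁.valuation ϖ) ∧ let B₁ : Subring K₁ := Subring.closure ((algebraMap K K₁) '' (B : Set K) ∪ {x | x ∈ L ∧ x ∈ O₁}); ∃ J : Ideal B₁, (∃ N : ℕ, ϖ ^ N ∈ Subtype.val '' (J : Set B₁)) ∧ (∀ σ : K₁ ≃ₐ[K] K₁, (∀ x ∈ L, x ∈ O₁ → σ x ∈ O₁) → ∀ x ∈ Subtype.val '' (J : Set B₁), σ x ∈ Subtype.val '' (J : Set B₁)) ∧ Literature.AlgebraicGeometry.Resolution.IsLocalBlowupAlong O₁ B₁ J B₂ ∧ ∃ (_ : IsRegularLocalRing B₂) (n : ℕ) (x : Fin n → IsLocalRing.maximalIdeal B₂) (u : B₂ˣ), LinearIndependent (IsLocalRing.ResidueField B₂) (fun i => (IsLocalRing.maximalIdeal B₂).toCotangent (x i)) ∧ ϖ = ((u : B₂) : K₁) * ∏ i, (((x i : IsLocalRing.maximalIdeal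 B₂) : B₂) : K₁)

/-- item stmt-ResolutionOfSingularities-18607 · crux · rank 3 · open · by planner
why it might fail: wild ℤ/p-quotient singularities are resolved only for surfaces; in relative dim ≥ 2 the equivariant game making each augmentation ideal principal (KL criterion) may not terminate, and ϖ-supported centres may be too few to separate the fixed locus.
sources: KiralyLutkebohmert2013, BerghRydh2019, Lorenzini2013, ObusWewers2019, Zavyalov2024
[crux] local uniformization of vertically ramified wild quotients of semistable local rings: k = k̄
of char p, K₁ a field, D ≤ Aut_k(K₁) finite, O₁ a height-one valuation ring of K₁, L = k(ϖ, θ) a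
one-variable function field with ϖ a uniformizer of Λ' = O₁ ∩ L, D stabilising Λ' and acting
faithfully on it; C₁ ⊇ Λ' finitely generated and D-stable, J ⊆ C₁ ϖ-admissible and D-stable with
local blow-up B₂ along O₁ semistable over Λ'. Then on F₀ = K₁^D the ring C₁ ∩ F₀ admits a finite
tower of local blow-ups along O₁ ∩ F₀, each centre containing a nonzero element of Λ'^D, ending in a
regular local ring (sketch K2 — the new lever). [difficulty: XL] -/
@[route_item "route-ResolutionOfSingularities-AnalyticWildDescent", crux]
def VerticalWildQuotientLU : Prop :=
  ∀ p : ℕ, p.Prime → ∀ (k : Type) [Field k] [CharP k p] [IsAlgClosed k] (K₁ : Type) [Field K₁] [Algebra k K₁] (D : Subgroup (K₁ ≃ₐ[k] K₁)) [Finite D] (O₁ : ValuationSubring K₁) (L : IntermediateField k K₁) (θ ϖ : K₁) (C₁ : Subring K₁) (J : Ideal C₁) (B₂ : Subring K₁), Nonempty O₁.valuation.RankOne → IsAlgebraic (IntermediateField.adjoin k ({ϖ} : Set K₁)) θ → L = IntermediateField.adjoin k ({ϖ, θ} : Set K₁) → O₁.valuation ϖ < 1 → (∀ x ∈ L, O₁.valuation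 x < 1 → O₁.valuation x ≤ O₁.valuation ϖ) → (∀ σ ∈ D, ∀ x ∈ L, x ∈ O₁ → σ x ∈ L ∧ σ x ∈ O₁) → (∀ σ ∈ D, σ ≠ 1 → ∃ x ∈ L, x ∈ O₁ ∧ σ x ≠ x) → (∃ s : Finset K₁, C₁ = Subring.closure ({x | x ∈ L ∧ x ∈ O₁} ∪ ↑s)) → (∀ σ ∈ D, ∀ x ∈ C₁, σ x ∈ C₁) → (∃ N : ℕ, ϖ ^ N ∈ Subtype.val '' (J : Set C₁)) → (∀ σ ∈ D, ∀ x ∈ Subtype.val '' (J : Set C₁), σ x ∈ Subtype.val '' (J : Set C₁)) → Literature.AlgebraicGeometry.Resolution.IsLocalBlowupAlong O₁ C₁ J B₂ → (∃ (_ : IsRegularLocalRing B₂) (n : ℕ) (x : Fin n → IsLocalRing.maximalIdeal B₂) (u : B₂ˣ), LinearIndependent (IsLocalRing.ResidueField B₂) (fun i => (IsLocalRing.maximalIdeal B₂).toCotangent (x i)) ∧ ϖ = ((u : B₂) : K₁) * ∏ i, (((x i : IsLocalRing.maximalIdeal B₂) : B₂) : K₁)) → let F₀ : IntermediateField k K₁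 := IntermediateField.fixedField D; let ι : F₀ →+* K₁ := algebraMap F₀ K₁; ∃ N' : Subring F₀, Relation.ReflTransGen (fun N N' : Subring F₀ => ∃ I : Ideal N, (∃ a ∈ I, (a : F₀) ≠ 0 ∧ ι (a : F₀) ∈ L ∧ ι (a : F₀) ∈ O₁) ∧ Literature.AlgebraicGeometry.Resolution.IsLocalBlowupAlong (O₁.comap ι) N I N') (C₁.comap ι) N' ∧ IsRegularLocalRing N'

/-- item stmt-ResolutionOfSingularities-18608 · crux · rank 4 · open · by planner
why it might fail: tower descent needs each downstairs centre to meet Λ'^D nontrivially (typed so) and Λ'^D/k[t]_(t) étale-local with e = f = 1 (uses D = full inertia, k = k̄); the local Bertini pencil needs B localised at a value-zero element first — a slip breaks the glue, not the line.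
sources: NovacoskiSpivakovsky2014, Temkin2023, KnafKuhlmann2005, CossartPiltant2019
[crux] the glue: C1 and C2 imply relative local uniformization along every height-one valuation of a
function field over an algebraically closed field of characteristic p (local Bertini pencil making
the germ smooth over k(t); re-presentation L = k(ϖ, θ') and the quotient datum for D = Stab(Λ') =
inertia; Nisnevich descent of the admissible tower from K₁^D = K·L^D, étale-local over K with e = f
= 1 at the centre, back to K). [deps: EquivariantSemistableLU, VerticalWildQuotientLU] [difficulty:
L] -/
@[route_item "route-ResolutionOfSingularities-AnalyticWildDescent", crux]
def SwallowingPencilDecompletion : Prop :=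
  EquivariantSemistableLU → VerticalWildQuotientLU → ∀ p : ℕ, p.Prime → ∀ (k : Type) [Field k] [CharP k p] [IsAlgClosed k] (K : Type) [Field K] [Algebra k K] (O : ValuationSubring K), Nonempty O.valuation.RankOne → Literature.AlgebraicGeometry.Resolution.RelLocalUniformization k K O

/-- item stmt-ResolutionOfSingularities-0549 · support · rank 9 · open · by planner
sources: CossartPiltant2019, DeJong1996
PerfectToAll: for a prime p, resolution of all reduced separated finite-type schemes over all
PERFECT fields of char p implies ResolutionInChar p (all fields of char p). Expected inputs:
Neron-Popescu (Stacks 07GC), spreading out, openness of regular locus on excellent schemes;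
regularity is not stable under inseparable ground field extension, which is the difficulty. -/
@[route_item "route-ResolutionOfSingularities-AnalyticWildDescent", crux]
def DescentPerfectToAll : Prop :=
  ∀ p : ℕ, p.Prime → (∀ (k : Type) [Field k] [CharP k p] [PerfectField k] (X : AlgebraicGeometry.Scheme.{0}) (f : X ⟶ AlgebraicGeometry.Spec (.of k)), AlgebraicGeometry.IsSeparated f → AlgebraicGeometry.LocallyOfFiniteType f → AlgebraicGeometry.QuasiCompact f → AlgebraicGeometry.IsReduced X → Literature.AlgebraicGeometry.Resolution.Scheme.HasResolution X) → Literature.AlgebraicGeometry.Resolution.ResolutionInChar.{0} p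

/-- item stmt-ResolutionOfSingularities-0550 · support · rank 9 · open · by planner
sources: CossartPiltant2019, DeJong1996
AlgClosedToPerfect: for a prime p, resolution of all reduced separated finite-type schemes over all
ALGEBRAICALLY CLOSED fields of char p implies the same over all PERFECT fields of char p. Needs
Galois descent of some resolution (a Gal-invariant one), i.e. a canonicity input, or a trick
avoiding it. -/
@[route_item "route-ResolutionOfSingularities-AnalyticWildDescent", crux]
def DescentAlgclosedToPerfect : Prop :=
  ∀ p : ℕ, p.Prime → (∀ (k : Type) [Field k] [CharP k p] [IsAlgClosed k] (X : AlgebraicGeometry.Scheme.{0}) (f : X ⟶ AlgebraicGeometry.Spec (.of k)), AlgebraicGeometry.IsSeparated f → AlgebraicGeometry.LocallyOfFiniteType f → AlgebraicGeometry.QuasiCompact f → AlgebraicGeometry.IsReduced X → Literature.AlgebraicGeometry.Resolution.Scheme.HasResolution X) → ∀ (k : Type) [Field k] [CharP k p] [PerfectField k] (X : AlgebraicGeometry.Scheme.{0}) (f : X ⟶ AlgebraicGeometry.Spec (.of k)), AlgebraicGeometry.IsSeparated f → AlgebraicGeometry.LocallyOfFiniteType f → AlgebraicGeometry.QuasiCompact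 f → AlgebraicGeometry.IsReduced X → Literature.AlgebraicGeometry.Resolution.Scheme.HasResolution X

/-- item stmt-ResolutionOfSingularities-16089 · support · rank 9 · open · by planner
sources: CossartPiltant2019, NovacoskiSpivakovsky2014
[crux] ZARISKI PATCHING OVER ONE PERFECT FIELD: for k perfect of characteristic p, relative local
uniformization for all finitely generated fields K/k (LurelPerfect at k) implies that every reduced
separated k-scheme of finite type has a resolution. The tree PROVES the reduction to Piltant's
two-model patching of projective models over k
(Literature.AlgebraicGeometry.Resolution.resolutionOverUpToDim_of_twoModelPatching_of_relLU with
exists_topologicalKrullDim_le_of_locallyOfFiniteType), so the open content is exactly: any two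
projective models M₁, M₂ of K/k are dominated by a third N with φᵢ⁻¹(Reg Mᵢ) ⊆ Reg N (Piltant2013
Prop 5.1, P = P_reg) over perfect k. [difficulty: open-problem] -/
@[route_item "route-ResolutionOfSingularities-AnalyticWildDescent", crux]
def PatchingPerfect : Prop :=
  ∀ p : ℕ, p.Prime → ∀ (k : Type) [Field k] [CharP k p] [PerfectField k], (∀ (K : Type) [Field K] [Algebra k K], (⊤ : IntermediateField k K).FG → ∀ O : ValuationSubring K, (∀ c : k, algebraMap k K c ∈ O) → ∀ R : Subalgebra k K, R.FG → R.toSubring ≤ O.toSubring → ∃ (A : Subalgebra k K) (h : A.toSubring ≤ O.toSubring), R ≤ A ∧ A.FG ∧ IsFractionRing A K ∧ IsRegularLocalRing (Localization.AtPrime (Ideal.comap (Subring.inclusion h) (IsLocalRing.maximalIdeal O)))) → ∀ (X : AlgebraicGeometry.Scheme.{0}) (f : X ⟶ AlgebraicGeometry.Spec (.of k)), AlgebraicGeometry.IsSeparated f → AlgebraicGeometry.LocallyOfFiniteType f → AlgebraicGeometry.QuasiCompact f → AlgebraicGeometry.IsReduced X → Literature.AlgebraicGeometry.Resolution.Scheme.HasResolution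 X

/-- item stmt-ResolutionOfSingularities-18609 · assembly · rank 1 · open · by planner
sources: NovacoskiSpivakovsky2014, CossartPiltant2019
[assembly] EquivariantSemistableLU → VerticalWildQuotientLU → SwallowingPencilDecompletion →
PatchingPerfect → DescentAlgclosedToPerfect → DescentPerfectToAll → the sub-problem statement
ResolutionOfSingularities. -/
@[route_item "route-ResolutionOfSingularities-AnalyticWildDescent"]
def Assembly : Prop :=
  EquivariantSemistableLU → VerticalWildQuotientLU → SwallowingPencilDecompletion → PatchingPerfect → DescentAlgclosedToPerfect → DescentPerfectToAll → _root_.ResolutionOfSingularities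

/-! D-0027 §2.1 — DECIDING THEOREM (planner-authored via `route open/edit --closes-file`; by planner-type-99fce32726-0 2026-08-17T16:47:52Z):
its hypotheses are this route's items and its conclusion the sub-problem Statement (glue_lint), and it elaborates with this file. -/

/-- DECIDING THEOREM: height-one relative LU over algebraically closed fields (C3 fed by C1, C2),
all heights by the in-tree Novacoski–Spivakovsky reduction, resolution over algebraically closed
fields by patching, then the two descents. -/
@[closes "route-ResolutionOfSingularities-AnalyticWildDescent"] theorem closes (h₁ : EquivariantSemistableLU) (h₂ : VerticalWildQuotientLU)
    (h₃ : SwallowingPencilDecompletion) (hP : PatchingPerfect)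
    (hD₁ : DescentAlgclosedToPerfect) (hD₂ : DescentPerfectToAll) :
    _root_.ResolutionOfSingularities := by
  intro p hp
  refine hD₂ p hp (hD₁ p hp ?_)
  intro k _ _ _ X f hs hl hq hr
  refine hP p hp k ?_ X f hs hl hq hr
  intro K _ _ hfg O hO R hR hRO
  have hLU : ∀ (K : Type) [Field K] [Algebra k K] (O : ValuationSubring K),
      Literature.AlgebraicGeometry.Resolution.RelLocalUniformization k K O :=
    Literature.AlgebraicGeometry.Resolution.NovacoskiSpivakovsky2014_holds k
      (fun K _ _ O hO₁ => h₃ h₁ h₂ p hp k K O hO₁)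
  obtain ⟨R₀, hR₀O, hR₀fg, hR₀frac⟩ :=
    Literature.AlgebraicGeometry.Resolution.exists_affineModel k K hfg O hO
  haveI := hR₀frac
  have hfrac : IsFractionRing ↥(R ⊔ R₀) K :=
    Literature.AlgebraicGeometry.Resolution.isFractionRing_subalgebra_of_le R₀ (R ⊔ R₀) le_sup_right
  let OA : Subalgebra k K :=
    { carrier := O, mul_mem' := O.mul_mem _ _, one_mem' := O.one_mem, add_mem' := O.add_mem _ _,
      zero_mem' := O.zero_mem, algebraMap_mem' := hO }
  have hsup : R ⊔ R₀ ≤ OA := sup_le (fun x hx => hRO hx) (fun x hx => hR₀O hx)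
  have hle : (R ⊔ R₀).toSubring ≤ O.toSubring := fun x hx => hsup hx
  obtain ⟨A, hA, hRA, hAfg, hreg⟩ := hLU K O (R ⊔ R₀) (hR.sup hR₀fg) hfrac hle
  haveI := hfrac
  exact ⟨A, hA, le_sup_left.trans hRA, hAfg,
    Literature.AlgebraicGeometry.Resolution.isFractionRing_subalgebra_of_le (R ⊔ R₀) A hRA, hreg⟩

end Summit.ResolutionOfSingularities.ResolutionOfSingularities.Theses.AnalyticWildDescent
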